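import Mathlib
import HarnessLib
import Summits.Parity.Statement
import Summits.Parity.GeneralizedHardyLittlewood.Theses.SiegelSpectrumSplit
import Literature.Barriers.Parity.SiegelZeroPrimePairs
import Literature.Barriers.Parity.SiegelZeroDichotomy
import Literature.Barriers.Parity.SiegelZeroDichotomyNoSiegelZeros
import Literature.Barriers.Parity.SiegelZeroDichotomyPairHLStepTwo
import Literature.NumberTheory.Sieve.LinearEquationsInPrimesTwinSystem
import Literature.NumberTheory.Sieve.SingularSeriesPairProofs
import Literature.NumberTheory.Sieve.HardyLittlewoodProofs
import Literature.NumberTheory.Sieve.ClusterComplexity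
import Literature.NumberTheory.LFunctions.Zhang2022.SkeletonSetting
import Summits.Parity.GeneralizedHardyLittlewood.Theorems.RangeQualityExchangeDefs

/-!
# Range–quality exchange (1/5): the shift-range dial, range-reaching zeros, the CORE obstruction (upper side)

Part of the decomp-parity lens-5 g10 certificate «RangeQualityExchange» (NODE HOME/STATUS.md l.484, critic CLEARED l.490 =
CRITIC-LEDGER row 89, writer DECISION L7 l.491: zero credit, helper beneath the existing leaf UU 26853), landed from the lens hand
`HOME/decomp-parity-lens-5/g10/hand/RangeQualityExchange.lean` (sha16 fc7ece3ca225b2c0, 1301 lines, rc 0 · 0 sorry · standard axioms)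
VERBATIM by section in five files for the 400-line Theorems lint by the cell's prover-class seat census-1 g10
(`RangeQualityExchangeCore` → `RangeQualityExchangeCoreLower` → `RangeQualityExchangeRate` → `RangeQualityExchangeNecessity` →
`RangeQualityExchange`; vocabulary `Theorems/RangeQualityExchangeDefs.lean`, p772649).  The hand's `private` shift-pair dictionary
copies (of `Theorems/PairsToGHL/Negative/{ShiftPairDictionary,UnboundedSiegelZeros}.lean`, which do not build on the current farm
snapshot, remote:stale:unbuilt 2026-08-30) stay `private` and sit in the part(s) that use them.

This file: `UniformUpperUpTo.anti` / `UniformLowerUpTo.anti`, `mm_correction_half`, and the upper CORE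
`not_uniformUpperUpTo_of_rangeReachingZeros` (the record kernel's template with the Matomäki–Merikoski scale exponent `V` freed).
[cite: MatomakiMerikoski2023, Theorem 1.3]
-/

open Finset Filter MeasureTheory
open scoped Topology ArithmeticFunction.vonMangoldt
open Literature.NumberTheory.Sieve Literature.Barriers.Parity
open Summit.Parity.GeneralizedHardyLittlewood.Theses

noncomputable section

namespace Summit.Parity.GeneralizedHardyLittlewood.RangeQualityExchange

/-! ## Private helper copies (see the module docstring; names and signatures identical to the unbuilt tree lemmas) -/

namespace Dictionary

/-! ### `𝔖(h) ≥ C₂ · h/φ(h)` for even `h` -/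

/-- `m/φ(m) = ∏_{p ∣ m} p/(p-1)` (from `φ(m) ∏_{p ∣ m} p = m ∏_{p ∣ m} (p - 1)`). [folklore] -/
private theorem self_div_totient_eq_prod {m : ℕ} (hm : m ≠ 0) :
    (m : ℝ) / (Nat.totient m : ℝ) = ∏ p ∈ m.primeFactors, ((p : ℝ) / ((p : ℝ) - 1)) := by
  have key := Nat.totient_mul_prod_primeFactors m
  have hφ : (0 : ℝ) < Nat.totient m := by
    exact_mod_cast Nat.totient_pos.mpr (Nat.pos_of_ne_zero hm)
  have hcast : (((∏ p ∈ m.primeFactors, (p - 1) : ℕ)) : ℝ) = ∏ p ∈ m.primeFactors, ((p : ℝ) - 1) := by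
    rw [Nat.cast_prod]
    refine Finset.prod_congr rfl fun p hp => ?_
    rw [Nat.cast_sub (Nat.prime_of_mem_primeFactors hp).one_le, Nat.cast_one]
  have keyR : (Nat.totient m : ℝ) * ∏ p ∈ m.primeFactors, (p : ℝ) =
      (m : ℝ) * ∏ p ∈ m.primeFactors, ((p : ℝ) - 1) := by
    have := congrArg (Nat.cast : ℕ → ℝ) key
    rw [Nat.cast_mul, Nat.cast_mul, hcast, Nat.cast_prod] at this
    exact this
  have hne : ∏ p ∈ m.primeFactors, ((p : ℝ) - 1) ≠ 0 := by
    refine Finset.prod_ne_zero_iff.mpr fun p hp => ?_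
    have : (2 : ℝ) ≤ p := by exact_mod_cast (Nat.prime_of_mem_primeFactors hp).two_le
    linarith
  rw [Finset.prod_div_distrib, div_eq_div_iff hφ.ne' hne]
  linarith [keyR]

/-- For even `m ≠ 0`: `C₂ · m/φ(m) ≤ 𝔖(m) = 2C₂ ∏_{p ∣ m, p > 2} (p-1)/(p-2)`, since
`m/φ(m) = 2 ∏_{p ∣ m, p > 2} p/(p-1)` and `p/(p-1) ≤ (p-1)/(p-2)`. [folklore] -/
private theorem twinPrimeConst_mul_le_goldbachSingularSeries {m : ℕ} (hm : Even m) (h0 : m ≠ 0) :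
    twinPrimeConst * ((m : ℝ) / (Nat.totient m : ℝ)) ≤ goldbachSingularSeries m := by
  rw [goldbachSingularSeries_of_even m hm, self_div_totient_eq_prod h0]
  have h2 : 2 ∈ m.primeFactors :=
    Nat.mem_primeFactors.mpr ⟨Nat.prime_two, even_iff_two_dvd.mp hm, h0⟩
  rw [← Finset.mul_prod_erase _ _ h2]
  have herase : m.primeFactors.erase 2 = m.primeFactors.filter (2 < ·) := by
    ext p
    simp only [Finset.mem_erase, Finset.mem_filter, Nat.mem_primeFactors]
    constructor
    · rintro ⟨hne, hp, hdvd, hm0⟩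
      exact ⟨⟨hp, hdvd, hm0⟩, lt_of_le_of_ne hp.two_le (Ne.symm hne)⟩
    · rintro ⟨⟨hp, hdvd, hm0⟩, h2p⟩
      exact ⟨h2p.ne', hp, hdvd, hm0⟩
  have hβ2 : ((2 : ℕ) : ℝ) / (((2 : ℕ) : ℝ) - 1) = 2 := by norm_num
  rw [herase, hβ2]
  have hC : 0 < twinPrimeConst := twinPrimeConst_pos_holds
  have hle : ∏ p ∈ m.primeFactors.filter (2 < ·), ((p : ℝ) / ((p : ℝ) - 1)) ≤
      ∏ p ∈ m.primeFactors.filter (2 < ·), (((p : ℝ) - 1) / ((p : ℝ) - 2)) := by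
    refine Finset.prod_le_prod (fun p hp => ?_) (fun p hp => ?_)
    · have : (3 : ℝ) ≤ p := by exact_mod_cast (Finset.mem_filter.mp hp).2
      exact div_nonneg (by linarith) (by linarith)
    · have hp3 : (3 : ℝ) ≤ p := by exact_mod_cast (Finset.mem_filter.mp hp).2
      rw [div_le_div_iff₀ (by linarith) (by linarith)]
      nlinarith
  calc twinPrimeConst * (2 * ∏ p ∈ m.primeFactors.filter (2 < ·), ((p : ℝ) / ((p : ℝ) - 1)))
      = 2 * twinPrimeConst * ∏ p ∈ m.primeFactors.filter (2 < ·), ((p : ℝ) / ((p : ℝ) - 1)) := by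
        ring
    _ ≤ 2 * twinPrimeConst * ∏ p ∈ m.primeFactors.filter (2 < ·), (((p : ℝ) - 1) / ((p : ℝ) - 2)) :=
        mul_le_mul_of_nonneg_left hle (by linarith)

/-! ### The Matomäki–Merikoski correction factor at `h = 2q` -/

/-- At the shift `h = 2q` the correction factor of Matomäki–Merikoski's Theorem 1.3 equals `+1`, so
the main term DOUBLES: `φ(2^r) ∣ 2q` (`r = v₂(q)`), `2q/φ(2^r)` is even, and every prime factor of
`q' = q/2^r` divides `2q` (empty product). [cite: MatomakiMerikoski2023, Theorem 1.3] -/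
private theorem mm_correction_two_mul {q : ℕ} (hq : 0 < q) :
    (1 + if Nat.totient (2 ^ padicValNat 2 q) ∣ 2 * q then
        (-1 : ℝ) ^ (2 * q / Nat.totient (2 ^ padicValNat 2 q)) *
          ∏ p ∈ (q / 2 ^ padicValNat 2 q).primeFactors.filter (fun p => ¬ p ∣ 2 * q),
            (-1 : ℝ) / ((p : ℝ) - 2)
      else 0) = 2 := by
  have _hq := hq
  set r := padicValNat 2 q with hr
  have ht : Nat.totient (2 ^ r) ∣ q := by
    rcases Nat.eq_zero_or_pos r with h0 | hpos
    · rw [h0, pow_zero, Nat.totient_one]; exact one_dvd q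
    · rw [Nat.totient_prime_pow Nat.prime_two hpos]
      calc 2 ^ (r - 1) * (2 - 1) = 2 ^ (r - 1) := by norm_num
        _ ∣ 2 ^ r := pow_dvd_pow 2 (Nat.sub_le r 1)
        _ ∣ q := pow_padicValNat_dvd
  have hdvd : Nat.totient (2 ^ r) ∣ 2 * q := ht.trans (dvd_mul_left q 2)
  have heven : Even (2 * q / Nat.totient (2 ^ r)) := by
    obtain ⟨m, hm⟩ := ht
    have htpos : 0 < Nat.totient (2 ^ r) := Nat.totient_pos.mpr (pow_pos two_pos r)
    refine ⟨m, ?_⟩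
    rw [show 2 * q = Nat.totient (2 ^ r) * (m + m) by rw [hm]; ring, Nat.mul_div_cancel_left _ htpos]
  have hempty : (q / 2 ^ r).primeFactors.filter (fun p => ¬ p ∣ 2 * q) = ∅ := by
    refine Finset.filter_eq_empty_iff.mpr fun p hp hndvd => hndvd ?_
    exact ((Nat.dvd_of_mem_primeFactors hp).trans
      (Nat.div_dvd_of_dvd pow_padicValNat_dvd)).trans (dvd_mul_left q 2)
  rw [if_pos hdvd, heven.neg_one_pow, hempty, Finset.prod_empty]
  norm_num

end Dictionary

open Dictionary

/-! ## The shift-range dial (bare, unconditioned) -/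



/-- The dial is monotone: a longer range is a stronger statement. [folklore] -/
theorem UniformUpperUpTo.anti {R R' : ℕ → ℝ} (hRR' : ∀ N, R' N ≤ R N) (h : UniformUpperUpTo R) :
    UniformUpperUpTo R' := by
  intro ε hε
  obtain ⟨N₀, hN₀⟩ := h ε hε
  exact ⟨N₀, fun N hN k hk0 hke hkN hkR => hN₀ N hN k hk0 hke hkN (hkR.trans (hRR' N))⟩

/-- The dial is monotone (lower side). [folklore] -/
theorem UniformLowerUpTo.anti {R R' : ℕ → ℝ} (hRR' : ∀ N, R' N ≤ R N) (h : UniformLowerUpTo R) :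
    UniformLowerUpTo R' := by
  intro ε hε
  obtain ⟨N₀, hN₀⟩ := h ε hε
  exact ⟨N₀, fun N hN k hk0 hke hkN hkR => hN₀ N hN k hk0 hke hkN (hkR.trans (hRR' N))⟩

/-! ## Zeros whose Matomäki–Merikoski window reaches the range -/



/-- At the shift `h = q/2`, `4 ∣ q`, the correction factor of Matomäki–Merikoski's Theorem 1.3 is `-1`
(main term vanishes): `r = v₂(q) ≥ 2`, `φ(2^r) = 2^{r-1} ∣ q/2 = 2^{r-1} q'`, `q'` odd, and every prime
factor of `q'` divides `q/2`. (Verbatim the record kernel's `mm_correction_half`,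
HOME/decomp-parity-lens-5/SiegelSpectrumSplit.lean.) [cite: MatomakiMerikoski2023, Theorem 1.3] -/
theorem mm_correction_half {q : ℕ} (hq : q ≠ 0) (h4 : 4 ∣ q) :
    (1 + if Nat.totient (2 ^ padicValNat 2 q) ∣ q / 2 then
        (-1 : ℝ) ^ (q / 2 / Nat.totient (2 ^ padicValNat 2 q)) *
          ∏ p ∈ (q / 2 ^ padicValNat 2 q).primeFactors.filter (fun p => ¬ p ∣ q / 2),
            (-1 : ℝ) / ((p : ℝ) - 2)
      else 0) = 0 := by
  set r := padicValNat 2 q with hr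
  have hr2 : 2 ≤ r := (padicValNat_dvd_iff_le (p := 2) hq).mp (by norm_num; exact h4)
  have hqr : 2 ^ r ∣ q := pow_padicValNat_dvd
  set q' := q / 2 ^ r with hq'
  have hqq : q = 2 ^ r * q' := (Nat.mul_div_cancel' hqr).symm
  have hodd' : ¬ 2 ∣ q' := by
    have h := Nat.not_dvd_ordCompl Nat.prime_two hq
    rw [Nat.factorization_def q Nat.prime_two] at h
    exact h
  have hodd : Odd q' := Nat.odd_iff.mpr (Nat.two_dvd_ne_zero.mp hodd')
  have htot : Nat.totient (2 ^ r) = 2 ^ (r - 1) := by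
    rw [Nat.totient_prime_pow Nat.prime_two (by omega)]; simp
  have hhalf : q / 2 = 2 ^ (r - 1) * q' := by
    have h2r : 2 ^ r = 2 * 2 ^ (r - 1) := by
      rw [← pow_succ']; congr 1; omega
    rw [hqq, h2r, mul_assoc, Nat.mul_div_cancel_left _ two_pos]
  have hdvd : Nat.totient (2 ^ r) ∣ q / 2 := by
    rw [htot, hhalf]; exact dvd_mul_right _ _
  have hquot : q / 2 / Nat.totient (2 ^ r) = q' := by
    rw [htot, hhalf, Nat.mul_div_cancel_left _ (pow_pos two_pos _)]
  have hempty : (q').primeFactors.filter (fun p => ¬ p ∣ q / 2) = ∅ := by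
    refine Finset.filter_eq_empty_iff.mpr fun p hp hndvd => hndvd ?_
    rw [hhalf]
    exact (Nat.dvd_of_mem_primeFactors hp).trans (dvd_mul_left _ _)
  rw [if_pos hdvd, hquot, hodd.neg_one_pow, hempty, Finset.prod_empty]
  norm_num

/-! ## CORE: the asymptotic regime, with the scale exponent `V` free -/

/-- **Range-reaching zeros refute uniform upper pair-HL up to that range** (mod Matomäki–Merikoski
Theorem 1.3). At `N = X = q^V`, `h = 2q ≤ R(N)` the dial predicts `∑ Λ(n)Λ(n+2q) ≤ N𝔖(2q) + (C₂/4)N`,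
whereas the exceptional zero gives `2N𝔖(2q)` up to
`K (h/φ(h)) N (e^{-√(V log η)} + e^{-(log N)^{1/2}} + V log⁶η/η) ≤ K (h/φ(h)) N · 3δ`, `δ = C₂/(12K)`
(`mm_correction_two_mul`), and `𝔖(2q) ≥ C₂ · 2q/φ(2q)`: contradiction. The record kernel's proof is
the case `V = 10`. [cite: MatomakiMerikoski2023, Theorem 1.3] -/
theorem not_uniformUpperUpTo_of_rangeReachingZeros {R : ℕ → ℝ}
    (hMM : MatomakiMerikoski2023_pairCorrelation) (hZ : RangeReachingZeros R) :
    ¬ UniformUpperUpTo R := by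
  intro hG
  have hC₂ : 0 < twinPrimeConst := twinPrimeConst_pos_holds
  obtain ⟨K, hK, hMM'⟩ := hMM 1 le_rfl (1 / 10) (by norm_num) 1 one_pos
  set δ : ℝ := twinPrimeConst / (12 * K) with hδ
  have hδpos : 0 < δ := by positivity
  obtain ⟨N₀, hN₀⟩ := hG (twinPrimeConst / 4) (by positivity)
  -- thresholds for the two `V`-free error terms
  have hT1 : ∀ᶠ η : ℝ in atTop, Real.exp (-1 * Real.sqrt (10 * Real.log η)) ≤ δ := by
    have h1 : Tendsto (fun η : ℝ => Real.exp (-1 * Real.sqrt (10 * Real.log η))) atTop (𝓝 0) := by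
      refine Real.tendsto_exp_atBot.comp ?_
      have : Tendsto (fun η : ℝ => Real.sqrt (10 * Real.log η)) atTop atTop :=
        Real.tendsto_sqrt_atTop.comp (Real.tendsto_log_atTop.const_mul_atTop (by norm_num))
      simpa using this.const_mul_atTop_of_neg (by norm_num : (-1 : ℝ) < 0)
    exact (h1.eventually (gt_mem_nhds hδpos)).mono fun _ h => h.le
  have hT3 : ∀ᶠ X : ℝ in atTop, Real.exp (-1 * Real.log X ^ (3 / 5 - 1 / 10 : ℝ)) ≤ δ := by
    have h1 : Tendsto (fun X : ℝ => Real.exp (-1 * Real.log X ^ (3 / 5 - 1 / 10 : ℝ))) atTop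
        (𝓝 0) := by
      refine Real.tendsto_exp_atBot.comp ?_
      have : Tendsto (fun X : ℝ => Real.log X ^ (3 / 5 - 1 / 10 : ℝ)) atTop atTop :=
        (tendsto_rpow_atTop (by norm_num)).comp Real.tendsto_log_atTop
      simpa using this.const_mul_atTop_of_neg (by norm_num : (-1 : ℝ) < 0)
    exact (h1.eventually (gt_mem_nhds hδpos)).mono fun _ h => h.le
  obtain ⟨η₁, hη₁⟩ := eventually_atTop.mp hT1
  obtain ⟨X₁, hX₁⟩ := eventually_atTop.mp hT3
  -- a range-reaching zero at a conductor `q ≥ max N₀ ⌈X₁⌉ 2` with quality `η ≥ η₁`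
  obtain ⟨q, inst, χ, η, V, hq, hη, ⟨hprim, hquad, hη10, hL⟩, hV10, hVη, hreach⟩ :=
    hZ δ hδpos η₁ (max N₀ (max ⌈X₁⌉₊ 2))
  have hqN₀ : N₀ ≤ q := le_of_max_le_left hq
  have hqX₁ : ⌈X₁⌉₊ ≤ q := le_of_max_le_left (le_of_max_le_right hq)
  have hq2 : 2 ≤ q := le_of_max_le_right (le_of_max_le_right hq)
  have hqpos : 0 < q := by omega
  have hV2 : 2 ≤ V := le_trans (by norm_num) hV10
  set N : ℕ := q ^ V with hN
  have hNpos : 0 < N := pow_pos hqpos V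
  have hNr : (0 : ℝ) < N := by exact_mod_cast hNpos
  have hqN : q ≤ N := by
    calc q = q ^ 1 := (pow_one q).symm
      _ ≤ q ^ V := Nat.pow_le_pow_right hqpos (by omega)
  have h2qN : 2 * q ≤ N := by
    calc 2 * q ≤ q * q := Nat.mul_le_mul_right q hq2
      _ = q ^ 2 := (sq q).symm
      _ ≤ q ^ V := Nat.pow_le_pow_right hqpos hV2
  set X : ℝ := (q : ℝ) ^ (V : ℝ) with hXdef
  have hXN : X = (N : ℝ) := by
    rw [hXdef, hN, Real.rpow_natCast, Nat.cast_pow]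
  -- Matomäki–Merikoski at `h = 2q`, scale `X = q^V`
  have hA : ((2 * q : ℕ) : ℝ) ≤ 1 * X := by
    rw [hXN, one_mul]; exact_mod_cast h2qN
  have hV10r : (10 : ℝ) ≤ (V : ℝ) := by exact_mod_cast hV10
  have hM := hMM' q hq2 χ hprim hquad η hη10 hL (V : ℝ) X hV10r hXdef (2 * q) (by omega) hA
  rw [mm_correction_two_mul hqpos, hXN, Nat.floor_natCast] at hM
  -- the dial at `N`, shift `2q ≤ R N`
  have hGq := hN₀ N (hqN₀.trans hqN) (2 * q) (by omega) (even_two_mul q) h2qN hreach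
  -- bookkeeping
  set S : ℝ := ∑ n ∈ Icc 1 N, Λ n * Λ (n + 2 * q) with hS
  set 𝔖 : ℝ := goldbachSingularSeries (2 * q) with h𝔖
  set ρ : ℝ := ((2 * q : ℕ) : ℝ) / (Nat.totient (2 * q) : ℝ) with hρ
  have hρ1 : 1 ≤ ρ := by
    have hφpos : (0 : ℝ) < (Nat.totient (2 * q) : ℝ) := by
      exact_mod_cast Nat.totient_pos.mpr (by omega)
    rw [hρ, le_div_iff₀ hφpos, one_mul]
    exact_mod_cast Nat.totient_le (2 * q)
  have hρ0 : 0 ≤ ρ := zero_le_one.trans hρ1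
  have h𝔖ρ : twinPrimeConst * ρ ≤ 𝔖 :=
    twinPrimeConst_mul_le_goldbachSingularSeries (even_two_mul q) (by omega)
  -- the three error terms are `≤ δ`
  have hE1 : Real.exp (-1 * Real.sqrt ((V : ℝ) * Real.log η)) ≤ δ := by
    have hlogη : 0 ≤ Real.log η := Real.log_nonneg (by linarith)
    have h10V : 10 * Real.log η ≤ (V : ℝ) * Real.log η := mul_le_mul_of_nonneg_right hV10r hlogη
    have hs := Real.sqrt_le_sqrt h10V
    exact le_trans (Real.exp_le_exp.mpr (by linarith)) (hη₁ η hη)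
  have hX₁N : X₁ ≤ (N : ℝ) :=
    (Nat.le_ceil X₁).trans (by exact_mod_cast hqX₁.trans hqN)
  have hE3 := hX₁ (N : ℝ) hX₁N
  -- `2N𝔖 - S ≤ KρN·3δ` and `S - N𝔖 ≤ (C₂/4)N`
  have hKρN : 0 ≤ K * ρ * (N : ℝ) := mul_nonneg (mul_nonneg hK.le hρ0) hNr.le
  have key : (N : ℝ) * 𝔖 ≤ K * ρ * N * (3 * δ) + twinPrimeConst / 4 * N := by
    have hM' : |S - (N : ℝ) * 𝔖 * 2| ≤ K * ρ * N * (3 * δ) :=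
      hM.trans (mul_le_mul_of_nonneg_left (by linarith) hKρN)
    have ha := neg_abs_le (S - (N : ℝ) * 𝔖 * 2)
    linarith
  have h3δ : K * ρ * (N : ℝ) * (3 * δ) = (N : ℝ) * (twinPrimeConst * ρ / 4) := by
    rw [hδ]; field_simp; ring
  rw [h3δ] at key
  have hfin : 𝔖 ≤ twinPrimeConst * ρ / 4 + twinPrimeConst / 4 := by
    have h' : (N : ℝ) * 𝔖 ≤ (N : ℝ) * (twinPrimeConst * ρ / 4 + twinPrimeConst / 4) := by linarith
    exact le_of_mul_le_mul_left h' hNr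
  have hCρ : twinPrimeConst * 1 ≤ twinPrimeConst * ρ := mul_le_mul_of_nonneg_left hρ1 hC₂.le
  linarith

end Summit.Parity.GeneralizedHardyLittlewood.RangeQualityExchange
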